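import Literature.Analysis.Distribution.SchwartzParameterIntegral
import Literature.MathematicalPhysics.QuantumLattice.SchwartzTranslationCutoff
import Mathlib.Analysis.Fourier.Convolution
import HarnessLib

/-!
# Approximate identities in the Schwartz space of the line: `α ⋆ β → β(· − x₀)` in `𝓢(ℝ, ℂ)`

Analysis/Distribution support file (everything proved; no definitions, no named facts). If
`α ∈ 𝓢(ℝ, ℂ)` is supported in `[a, b]`, then the convolution with a Schwartz function `β` is the
superposition of translates `α ⋆ β = ∫ₐᵇ α(t) β(· − t) dt`, so by the weak-integral principle of
`SchwartzParameterIntegral` every Schwartz seminorm of `α ⋆ β − (∫α) β(· − x₀)` is bounded by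
`∫ₐᵇ ‖α(t)‖ p(β(· − t) − β(· − x₀)) dt` (`SchwartzMap.seminorm_convolution_sub_smul_compSubConstCLM_le`);
consequently (`SchwartzMap.tendsto_convolution_of_tsupport_subset`) for kernels `αₙ` of mass one,
bounded in `L¹` and supported in `[x₀ − rₙ, x₀ + rₙ]` with `rₙ → 0`, **`αₙ ⋆ β → β(· − x₀)` in the
Schwartz topology** (continuity of translation on `𝓢`, the tree's
`Literature.MathematicalPhysics.QuantumLattice.continuous_compSubConstCLM`). Classical: Hörmander,
*ALPDO I*, Thm. 1.3.2 / Lemma 7.1.? (regularisation `u ⋆ φ_ε → u`); here in the Schwartz topology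
on the test-function side, the form consumed by tempered distributions `u(αₙ ⋆ β) → u(β(· − x₀))`
(continuity of `u`) — e.g. when the anchors of a cluster of Euclidean points shrink to a sharp
time (Osterwalder–Schrader II, Ch. V).

Everything here is tagged folklore.
-/

noncomputable section

open _root_.MeasureTheory Set Filter intervalIntegral
open scoped _root_.Topology SchwartzMap Convolution

namespace Literature.Analysis.Distribution

/-- **Convolution with a compactly supported Schwartz kernel is a superposition of translates, in
every Schwartz seminorm**: if `tsupport α ⊆ [a, b]` then for every `x₀` and every seminorm `p_{k,l}`,

  `p_{k,l}(α ⋆ β − (∫ α) • β(· − x₀)) ≤ ∫ₐᵇ ‖α t‖ · p_{k,l}(β(· − t) − β(· − x₀)) dt`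

(`SchwartzMap.seminorm_le_intervalIntegral_of_forall_apply_eq_integral` applied to the continuous
curve `t ↦ α(t) • (β(· − t) − β(· − x₀))` in `𝓢(ℝ, ℂ)`). [folklore] -/
theorem _root_.SchwartzMap.seminorm_convolution_sub_smul_compSubConstCLM_le (α β : 𝓢(ℝ, ℂ))
    {a b : ℝ} (hab : a ≤ b) (hsupp : tsupport (α : ℝ → ℂ) ⊆ Icc a b) (x₀ : ℝ) (k l : ℕ) :
    SchwartzMap.seminorm ℝ k l (SchwartzMap.convolution (ContinuousLinearMap.mul ℂ ℂ) α β -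
        (∫ t, α t) • SchwartzMap.compSubConstCLM ℝ x₀ β) ≤
      ∫ t in a..b, ‖α t‖ * SchwartzMap.seminorm ℝ k l
        (SchwartzMap.compSubConstCLM ℝ t β - SchwartzMap.compSubConstCLM ℝ x₀ β) := by
  -- the curve of translates
  set Φ : ℝ → 𝓢(ℝ, ℂ) := fun t => α t •
    (SchwartzMap.compSubConstCLM ℝ t β - SchwartzMap.compSubConstCLM ℝ x₀ β) with hΦ
  have hΦc : Continuous Φ :=
    α.continuous.smul ((Literature.MathematicalPhysics.QuantumLattice.continuous_compSubConstCLM ℝ β).sub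
      continuous_const)
  -- `α` vanishes off `[a, b]`
  have hzero : ∀ t, t ∉ Icc a b → α t = 0 := fun t ht => image_eq_zero_of_notMem_tsupport fun h => ht (hsupp h)
  have hmass : (∫ t, α t) = ∫ t in a..b, α t := by
    rw [intervalIntegral.integral_of_le hab, ← integral_Icc_eq_integral_Ioc,
      setIntegral_eq_integral_of_forall_compl_eq_zero hzero]
  -- the pointwise identity
  have hΨ : ∀ x : ℝ, (SchwartzMap.convolution (ContinuousLinearMap.mul ℂ ℂ) α β -
      (∫ t, α t) • SchwartzMap.compSubConstCLM ℝ x₀ β) x = ∫ t in a..b, Φ t x := by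
    intro x
    change SchwartzMap.convolution (ContinuousLinearMap.mul ℂ ℂ) α β x - (∫ t, α t) * β (x - x₀) =
      ∫ t in a..b, α t * (β (x - t) - β (x - x₀))
    rw [SchwartzMap.convolution_apply, convolution_def]
    simp only [ContinuousLinearMap.mul_apply']
    have hconv : (∫ t, α t * β (x - t)) = ∫ t in a..b, α t * β (x - t) := by
      rw [intervalIntegral.integral_of_le hab, ← integral_Icc_eq_integral_Ioc,
        setIntegral_eq_integral_of_forall_compl_eq_zero fun t ht => by rw [hzero t ht, zero_mul]]
    have h1 : IntervalIntegrable (fun t : ℝ => α t * β (x - t)) volume a b :=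
      Continuous.intervalIntegrable
        (by exact α.continuous.mul (β.continuous.comp (continuous_const.sub continuous_id))) _ _
    have h2 : IntervalIntegrable (fun t : ℝ => α t * β (x - x₀)) volume a b :=
      Continuous.intervalIntegrable (by exact α.continuous.mul continuous_const) _ _
    rw [hconv, hmass, ← intervalIntegral.integral_mul_const, ← intervalIntegral.integral_sub h1 h2]
    refine intervalIntegral.integral_congr fun t _ => ?_
    ring
  have hsm : ∀ (c : ℂ) (f : 𝓢(ℝ, ℂ)),
      SchwartzMap.seminorm ℝ k l (c • f) = ‖c‖ * SchwartzMap.seminorm ℝ k l f := fun c f =>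
    map_smul_eq_mul (SchwartzMap.seminorm ℂ k l) c f
  refine (SchwartzMap.seminorm_le_intervalIntegral_of_forall_apply_eq_integral hΦc hab hΨ k l).trans
    (le_of_eq ?_)
  refine intervalIntegral.integral_congr fun t _ => ?_
  simp only [hΦ, hsm]

/-- **Approximate identities converge in the Schwartz topology**: let `αₙ ∈ 𝓢(ℝ, ℂ)` have mass
`∫ αₙ = 1`, `L¹` norms `∫ ‖αₙ‖ ≤ C`, and supports in `[x₀ − rₙ, x₀ + rₙ]` with `rₙ → 0`, `rₙ > 0`.
Then `αₙ ⋆ β → β(· − x₀)` in `𝓢(ℝ, ℂ)` for every Schwartz `β` (each seminorm of the difference is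
at most `C · sup_{|t − x₀| ≤ rₙ} p(β(· − t) − β(· − x₀)) → 0` by the continuity of translation on
`𝓢`). [folklore] -/
theorem _root_.SchwartzMap.tendsto_convolution_of_tsupport_subset (α : ℕ → 𝓢(ℝ, ℂ)) (β : 𝓢(ℝ, ℂ))
    (x₀ : ℝ) {r : ℕ → ℝ} (hr : ∀ n, 0 < r n) (hr0 : Tendsto r atTop (𝓝 0))
    (hsupp : ∀ n, tsupport (α n : ℝ → ℂ) ⊆ Icc (x₀ - r n) (x₀ + r n))
    (hmass : ∀ n, ∫ t, α n t = 1) {C : ℝ} (hL1 : ∀ n, ∫ t, ‖α n t‖ ≤ C) :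
    Tendsto (fun n => SchwartzMap.convolution (ContinuousLinearMap.mul ℂ ℂ) (α n) β) atTop
      (𝓝 (SchwartzMap.compSubConstCLM ℝ x₀ β)) := by
  rw [(schwartz_withSeminorms ℝ ℝ ℂ).tendsto_nhds_atTop]
  rintro ⟨k, l⟩ ε hε
  -- continuity of translation at `x₀` in the seminorm `p_{k,l}`
  set T : ℝ → 𝓢(ℝ, ℂ) := fun t => SchwartzMap.compSubConstCLM ℝ t β with hT
  have hTc : Continuous T := Literature.MathematicalPhysics.QuantumLattice.continuous_compSubConstCLM ℝ β
  have hpc : Continuous fun t => SchwartzMap.seminorm ℝ k l (T t - T x₀) :=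
    ((schwartz_withSeminorms ℝ ℝ ℂ).continuous_seminorm (k, l)).comp (hTc.sub continuous_const)
  have hC0 : 0 ≤ C := le_trans (integral_nonneg fun t => norm_nonneg _) (hL1 0)
  obtain ⟨δ, hδ, hδε⟩ : ∃ δ : ℝ, 0 < δ ∧ ∀ t, |t - x₀| < δ →
      SchwartzMap.seminorm ℝ k l (T t - T x₀) < ε / (C + 1) := by
    have h := Metric.continuousAt_iff.1 (hpc.continuousAt (x := x₀)) (ε / (C + 1)) (by positivity)
    obtain ⟨δ, hδ, h⟩ := h
    refine ⟨δ, hδ, fun t ht => ?_⟩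
    have h' := h (by rwa [Real.dist_eq])
    simp only [sub_self, map_zero, dist_zero_right, Real.norm_eq_abs] at h'
    rw [abs_of_nonneg (apply_nonneg _ _)] at h'
    exact h'
  obtain ⟨N, hN⟩ := (Metric.tendsto_atTop.1 hr0) δ hδ
  refine ⟨N, fun n hn => ?_⟩
  have hrn : r n < δ := by simpa [Real.dist_eq, abs_of_pos (hr n)] using hN n hn
  simp only [schwartzSeminormFamily]
  -- the mass-one kernel: `(∫ αₙ) • T x₀ = T x₀`
  have hab : x₀ - r n ≤ x₀ + r n := by linarith [hr n]
  have h := SchwartzMap.seminorm_convolution_sub_smul_compSubConstCLM_le (α n) β hab (hsupp n) x₀ k l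
  rw [hmass n, one_smul] at h
  refine h.trans_lt ?_
  -- bound the integrand by `‖αₙ t‖ ε/(C+1)` on the support
  have hbound : ∫ t in (x₀ - r n)..(x₀ + r n), ‖α n t‖ * SchwartzMap.seminorm ℝ k l
      (SchwartzMap.compSubConstCLM ℝ t β - SchwartzMap.compSubConstCLM ℝ x₀ β) ≤
      ∫ t in (x₀ - r n)..(x₀ + r n), ‖α n t‖ * (ε / (C + 1)) := by
    refine intervalIntegral.integral_mono_on hab ?_ ?_ fun t ht => ?_
    · exact (((α n).continuous.norm).mul hpc).intervalIntegrable _ _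
    · exact (((α n).continuous.norm).mul continuous_const).intervalIntegrable _ _
    · refine mul_le_mul_of_nonneg_left (hδε t ?_).le (norm_nonneg _)
      rw [abs_lt]; constructor <;> linarith [ht.1, ht.2]
  refine hbound.trans_lt ?_
  rw [intervalIntegral.integral_mul_const]
  have hL1' : ∫ t in (x₀ - r n)..(x₀ + r n), ‖α n t‖ ≤ C := by
    rw [intervalIntegral.integral_of_le hab]
    exact (setIntegral_le_integral (α n).integrable.norm (Eventually.of_forall fun t => norm_nonneg _)).trans
      (hL1 n)
  have h0 : 0 ≤ ∫ t in (x₀ - r n)..(x₀ + r n), ‖α n t‖ :=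
    intervalIntegral.integral_nonneg hab fun t _ => norm_nonneg _
  calc (∫ t in (x₀ - r n)..(x₀ + r n), ‖α n t‖) * (ε / (C + 1)) ≤ C * (ε / (C + 1)) := by gcongr
    _ < ε := by
        rw [mul_div_assoc', div_lt_iff₀ (by positivity)]
        nlinarith

end Literature.Analysis.Distribution
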